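import Summits.Parity.GeneralizedHardyLittlewood.Theorems.PrimeLevelFamEdgeIdeaDeltasNegationRogue
import HarnessLib

/-!
# Route `PrimeLevelFamEdge` — TYPED IDEA DELTAS, deck 14f: K-L20-3 «THE ROGUE FORM», part 3 — THE KILL: the rogue family
# violates the transported K_A for EVERY `Δ > 1` and every level-free pair `(T₁, T₂)` (`not_momentAsymptoticsFam_rogue`:
# `(P, Q) = (X², 1)`, engine `le_three_mul_card_squarefree`, squeeze `c⁴ q̂^{(1+Δ')/2}/(72π) ≤ (K+|C|) q̂`; threshold
# EXACTLY the diagonal).  Seat ls-idea-lens-20 gen 2, `Sketch_L20c_RogueForm.lean` v10 sha16 64d60d2997a1fa36 l.558–817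
# VERBATIM up to the namespace relabel (typer ls-idea-typ-1 gen 3); critic E b8 PASS (kill arithmetic re-derived by E).
HONESTY: everything here is about TABLES (axiomatised families), which cannot instantiate `KMV2000.MomentAsymptotics`
(REF-E (E5)); nothing proves K_A (stmt-Parity-20007), K_B, any moment asymptotic or any exceptional-zero theorem (no
Landau–Siegel / Siegel-zero exclusion, no Theorem 1–2 of arXiv:2211.02515, no repaired Margin232); typed ≠ proved.
-/

noncomputable section

open scoped Real
open Finset Complex Polynomial CongruenceSubgroup
open Literature.NumberTheory.LFunctions
open Literature.NumberTheory.LFunctions.KMV2000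
open Literature.NumberTheory.EllipticCurves.ModularForms

namespace Summit.Parity.GeneralizedHardyLittlewood.Theorems.PrimeLevelFamEdgeIdeaDeltas.Negation

universe u

variable {α : Type u}
variable {β : ℕ → Type u}

/-! ## §5. THE KILL: the rogue family violates the transported K_A for EVERY `Δ > 1` -/

/-- `X²` is KMV-admissible (`P(0) = P'(0) = 0`). -/
theorem admissible_X_sq : KMV2000.Admissible (X ^ 2 : ℝ[X]) := by
  constructor <;> simp [Polynomial.derivative_pow]

/-- Termwise non-negativity of the rogue mollifier sum for `P = X²`. -/
theorem rogueMollSum_term_nonneg (M : ℝ) (m : ℕ) :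
    0 ≤ (ArithmeticFunction.moebius m : ℝ) ^ 2 *
      ((m : ℝ) ^ (-(1 / 2 : ℝ)) * (X ^ 2 : ℝ[X]).eval (Real.log (M / m) / Real.log M)) := by
  have h1 : 0 ≤ (m : ℝ) ^ (-(1 / 2 : ℝ)) := Real.rpow_nonneg (Nat.cast_nonneg m) _
  have h2 : 0 ≤ (X ^ 2 : ℝ[X]).eval (Real.log (M / m) / Real.log M) := by
    simp only [eval_pow, eval_X]
    positivity
  positivity

/-- LOWER BOUND for the rogue mollifier sum (`P = X²`): restricting to squarefree `m ≤ Y ≤ M` on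
which the logarithmic ratio is `≥ c ≥ 0` gives `S(M) ≥ c² Y^{-1/2} #{m ≤ Y squarefree}`. -/
theorem rogueMollSum_X_sq_ge {M Y c : ℝ} (hY : 0 ≤ Y) (hYM : Y ≤ M) (hc : 0 ≤ c)
    (hratio : ∀ m : ℕ, 1 ≤ m → (m : ℝ) ≤ Y → c ≤ Real.log (M / m) / Real.log M) :
    c ^ 2 * Y ^ (-(1 / 2 : ℝ)) * (((Icc 1 ⌊Y⌋₊).filter Squarefree).card : ℝ) ≤
      rogueMollSum (X ^ 2) M := by
  classical
  unfold rogueMollSum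
  have hsub : (Icc 1 ⌊Y⌋₊).filter Squarefree ⊆ Icc 1 ⌊M⌋₊ := by
    intro m hm
    rw [Finset.mem_filter, Finset.mem_Icc] at hm
    rw [Finset.mem_Icc]
    exact ⟨hm.1.1, hm.1.2.trans (Nat.floor_le_floor hYM)⟩
  refine le_trans ?_ (Finset.sum_le_sum_of_subset_of_nonneg hsub
    (fun m _ _ ↦ rogueMollSum_term_nonneg M m))
  have hconst : c ^ 2 * Y ^ (-(1 / 2 : ℝ)) * (((Icc 1 ⌊Y⌋₊).filter Squarefree).card : ℝ) =
      ∑ m ∈ (Icc 1 ⌊Y⌋₊).filter Squarefree, c ^ 2 * Y ^ (-(1 / 2 : ℝ)) := by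
    rw [Finset.sum_const, nsmul_eq_mul]
    ring
  rw [hconst]
  refine Finset.sum_le_sum fun m hm ↦ ?_
  rw [Finset.mem_filter, Finset.mem_Icc] at hm
  obtain ⟨⟨hm1, hmY⟩, hsq⟩ := hm
  have hmY' : (m : ℝ) ≤ Y := (Nat.cast_le.mpr hmY).trans (Nat.floor_le hY)
  have hm0 : (0 : ℝ) < m := by exact_mod_cast hm1
  have hμ : (ArithmeticFunction.moebius m : ℝ) ^ 2 = 1 := by
    rw [ArithmeticFunction.moebius_apply_of_squarefree hsq]
    push_cast
    rw [← pow_mul, mul_comm, pow_mul]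
    simp
  have hpow : Y ^ (-(1 / 2 : ℝ)) ≤ (m : ℝ) ^ (-(1 / 2 : ℝ)) :=
    Real.rpow_le_rpow_of_nonpos hm0 hmY' (by norm_num)
  have hev : c ^ 2 ≤ (X ^ 2 : ℝ[X]).eval (Real.log (M / m) / Real.log M) := by
    simp only [eval_pow, eval_X]
    exact pow_le_pow_left₀ hc (hratio m hm1 hmY') 2
  rw [hμ, one_mul]
  calc c ^ 2 * Y ^ (-(1 / 2 : ℝ)) = Y ^ (-(1 / 2 : ℝ)) * c ^ 2 := by ring
    _ ≤ (m : ℝ) ^ (-(1 / 2 : ℝ)) * (X ^ 2 : ℝ[X]).eval (Real.log (M / m) / Real.log M) :=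
      mul_le_mul hpow hev (sq_nonneg c) (Real.rpow_nonneg hm0.le _)

/-- The identity behind the threshold `Δ' = 1`: `w* · |Λ*(½)|² = q^{-3/2} · q̂ · q = 1/(2π)`. -/
theorem rogueW_mul_norm_jet_sq (q : ℕ) [NeZero q] :
    rogueW q * ‖rogueJet q 0‖ ^ 2 = 1 / (2 * Real.pi) := by
  have hq : (0 : ℝ) < q := by exact_mod_cast Nat.pos_of_ne_zero (NeZero.ne q)
  rw [rogueJet_zero, Complex.norm_real, Real.norm_eq_abs, sq_abs, mul_pow,
    Real.sq_sqrt (qhat_pos NeZero.one_le).le, Real.sq_sqrt hq.le]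
  unfold rogueW qhat
  rw [Real.sqrt_eq_rpow]
  have h1 : (q : ℝ) ^ (-(3 / 2 : ℝ)) * (q : ℝ) ^ (1 / 2 : ℝ) = (q : ℝ) ^ (-1 : ℝ) := by
    rw [← Real.rpow_add hq]
    norm_num
  have h2 : (q : ℝ) ^ (-1 : ℝ) * q = 1 := by
    rw [Real.rpow_neg_one, inv_mul_cancel₀ hq.ne']
  calc (q : ℝ) ^ (-(3 / 2 : ℝ)) * ((q : ℝ) ^ (1 / 2 : ℝ) / (2 * π) * q)
      = ((q : ℝ) ^ (-(3 / 2 : ℝ)) * (q : ℝ) ^ (1 / 2 : ℝ)) * q / (2 * π) := by ring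
    _ = 1 / (2 * π) := by rw [h1, h2]

/-- Real part of the rogue second display (`P = X²`, `Q = 1`):
`Re Q^h(rogue T) = S(M)²/(2π) + Re Q^h(T)`. -/
theorem re_QhF_rogue_X_sq_one (q : ℕ) [NeZero q] (T : FamTable α) (M : ℝ) :
    (QhF q (rogue q T) (X ^ 2) 1 M).re =
      1 / (2 * Real.pi) * rogueMollSum (X ^ 2) M ^ 2 + (QhF q T (X ^ 2) 1 M).re := by
  rw [QhF_rogue, Complex.add_re, ← Complex.ofReal_mul, Complex.ofReal_re, Polynomial.coeff_one_zero]
  congr 1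
  push_cast
  rw [one_mul, norm_mul, Complex.norm_real, Real.norm_eq_abs, mul_pow, sq_abs, ← mul_assoc,
    rogueW_mul_norm_jet_sq]

set_option maxHeartbeats 400000 in
/-- **THE KILL.** For EVERY family of tables with non-negative harmonic weights, EVERY `Δ > 1`
and EVERY level-free pair of polynomial corrections `(T₁, T₂)`, the rogue extension violates the
transported K_A display `MomentAsymptoticsFam · 1 Δ T₁ T₂`: at a good `Δ' ∈ (1, Δ)` the rogue's
own second-display term is `S(M)²/(2π) ≫ q̂^{(1+Δ')/2}`, the main term and the error are `O(q̂)`. -/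
theorem not_momentAsymptoticsFam_rogue (𝓕 : Tables β) (h𝓕 : NonnegFam 𝓕) {Δ : ℝ} (hΔ : 1 < Δ)
    (T₁ T₂ : ℝ → ℝ[X] → ℝ[X] → ℝ) : ¬ MomentAsymptoticsFam (rogueTables 𝓕) 1 Δ T₁ T₂ := by
  intro hMA
  obtain ⟨Δ', ⟨h1Δ', hΔ'Δ⟩, hgood⟩ := exists_mem_Ioo_qhat_rpow_ne_nat hΔ
  obtain ⟨C, q₀, hC⟩ := hMA (X ^ 2) 1 admissible_X_sq isEvenOrOdd_one Δ' h1Δ' hΔ'Δ.le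
  -- constants of the line
  have hΔ'pos : 0 < Δ' := by linarith
  obtain ⟨c, hc_def⟩ : ∃ c : ℝ, c = (Δ' - 1) / (2 * Δ') := ⟨_, rfl⟩
  obtain ⟨η, hη_def⟩ : ∃ η : ℝ, η = (Δ' - 1) / 2 := ⟨_, rfl⟩
  have hc_pos : 0 < c := by rw [hc_def]; exact div_pos (by linarith) (by linarith)
  have hη_pos : 0 < η := by rw [hη_def]; linarith
  have hcΔ : c * Δ' = η := by rw [hc_def, hη_def]; field_simp
  obtain ⟨K, hK_def⟩ : ∃ K : ℝ, K = ‖(2 : ℂ) * riemannZeta 2 ^ 2‖ * (1 / Δ' ^ 2) *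
      |KMV2000.secondMomentForm Δ' (X ^ 2) 1 + T₂ Δ' (X ^ 2) 1| := ⟨_, rfl⟩
  have hK0 : 0 ≤ K := by rw [hK_def]; positivity
  obtain ⟨B₀, hB₀_def⟩ : ∃ B₀ : ℝ, B₀ = 72 * Real.pi * (K + |C| + 1) / c ^ 4 := ⟨_, rfl⟩
  have hB₀pos : 0 < B₀ := by rw [hB₀_def]; positivity
  -- a large prime level
  obtain ⟨N₁, hN₁⟩ := exists_log_qhat_ge (max 1 (Real.log B₀ / η))
  obtain ⟨q, hqge, hqprime⟩ := Nat.exists_infinite_primes (max (max q₀ 300) N₁)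
  haveI : NeZero q := ⟨hqprime.ne_zero⟩
  have hq₀ : q₀ ≤ q := le_trans (le_trans (le_max_left _ _) (le_max_left _ _)) hqge
  have hq300 : 300 ≤ q := le_trans (le_trans (le_max_right _ _) (le_max_left _ _)) hqge
  have hqN₁ : N₁ ≤ q := le_trans (le_max_right _ _) hqge
  have hq40 : 40 ≤ q := by omega
  have hlog := hN₁ q hqN₁
  have hlog1 : 1 ≤ Real.log (qhat q) := le_trans (le_max_left _ _) hlog
  have hlogB : Real.log B₀ / η ≤ Real.log (qhat q) := le_trans (le_max_right _ _) hlog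
  have hqhat1 : 1 < qhat q := one_lt_qhat hq40
  have hqhatpos : 0 < qhat q := by linarith
  have hLpos : 0 < Real.log (qhat q) := by linarith
  -- the display at this level, with opaque names for `M = q̂^Δ'`, the main term and `S = S(M)`
  obtain ⟨_, h2⟩ := hC q hqprime hq₀ (hgood q hq40)
  obtain ⟨M, hM_def⟩ : ∃ M : ℝ, M = qhat q ^ Δ' := ⟨_, rfl⟩
  obtain ⟨MAIN, hMAIN_def⟩ : ∃ MAIN : ℂ, MAIN =
      (2 * riemannZeta 2 ^ 2 * ((qhat q / (Δ' ^ 2 * Real.log (qhat q) ^ 2) : ℝ) : ℂ)) *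
        ((KMV2000.secondMomentForm Δ' (X ^ 2) 1 + T₂ Δ' (X ^ 2) 1 : ℝ) : ℂ) := ⟨_, rfl⟩
  rw [← hM_def, ← hMAIN_def] at h2
  have h2' : ‖QhF q (rogue q (𝓕 q)) (X ^ 2) 1 M - MAIN‖ ≤
      C * qhat q * (Real.log (qhat q))⁻¹ ^ 3 := h2
  obtain ⟨S, hS_def⟩ : ∃ S : ℝ, S = rogueMollSum (X ^ 2) M := ⟨_, rfl⟩
  -- (i) the error is `≤ |C| q̂`
  have hup : ‖QhF q (rogue q (𝓕 q)) (X ^ 2) 1 M - MAIN‖ ≤ |C| * qhat q := by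
    refine h2'.trans ?_
    have hl : (Real.log (qhat q))⁻¹ ^ 3 ≤ 1 :=
      pow_le_one₀ (inv_nonneg.mpr hLpos.le) (inv_le_one_of_one_le₀ hlog1)
    have hA : 0 ≤ qhat q * (Real.log (qhat q))⁻¹ ^ 3 := by positivity
    calc C * qhat q * (Real.log (qhat q))⁻¹ ^ 3 = C * (qhat q * (Real.log (qhat q))⁻¹ ^ 3) := by ring
      _ ≤ |C| * (qhat q * (Real.log (qhat q))⁻¹ ^ 3) := mul_le_mul_of_nonneg_right (le_abs_self C) hA
      _ = |C| * qhat q * (Real.log (qhat q))⁻¹ ^ 3 := by ring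
      _ ≤ |C| * qhat q := mul_le_of_le_one_right (by positivity) hl
  -- (ii) the main term is `≤ K q̂`
  have hMAIN : ‖MAIN‖ ≤ K * qhat q := by
    rw [hMAIN_def, norm_mul, norm_mul, Complex.norm_real, Complex.norm_real, Real.norm_eq_abs,
      Real.norm_eq_abs]
    have hfrac : |qhat q / (Δ' ^ 2 * Real.log (qhat q) ^ 2)| ≤ qhat q * (1 / Δ' ^ 2) := by
      rw [abs_of_nonneg (by positivity), div_le_iff₀ (by positivity)]
      have : qhat q * (1 / Δ' ^ 2) * (Δ' ^ 2 * Real.log (qhat q) ^ 2) =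
          qhat q * Real.log (qhat q) ^ 2 := by
        field_simp
      rw [this]
      have hL2 : 1 ≤ Real.log (qhat q) ^ 2 := one_le_pow₀ hlog1
      nlinarith
    calc ‖(2 : ℂ) * riemannZeta 2 ^ 2‖ * |qhat q / (Δ' ^ 2 * Real.log (qhat q) ^ 2)| *
          |KMV2000.secondMomentForm Δ' (X ^ 2) 1 + T₂ Δ' (X ^ 2) 1|
        ≤ ‖(2 : ℂ) * riemannZeta 2 ^ 2‖ * (qhat q * (1 / Δ' ^ 2)) *
          |KMV2000.secondMomentForm Δ' (X ^ 2) 1 + T₂ Δ' (X ^ 2) 1| := by gcongr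
      _ = K * qhat q := by rw [hK_def]; ring
  -- (iii) the rogue term is squeezed: `S²/(2π) ≤ K q̂ + |C| q̂`
  have hRe := re_QhF_rogue_X_sq_one q (𝓕 q) M
  rw [← hS_def] at hRe
  have hReT : 0 ≤ (QhF q (𝓕 q) (X ^ 2) 1 M).re := re_QhF_nonneg q (𝓕 q) (h𝓕 q) (X ^ 2) 1 M
  have hsqueeze : 1 / (2 * Real.pi) * S ^ 2 ≤ K * qhat q + |C| * qhat q := by
    have hre_le : (QhF q (rogue q (𝓕 q)) (X ^ 2) 1 M - MAIN).re ≤ |C| * qhat q :=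
      le_trans (Complex.re_le_norm _) hup
    rw [Complex.sub_re, hRe] at hre_le
    have hMre : MAIN.re ≤ K * qhat q := le_trans (Complex.re_le_norm _) hMAIN
    linarith
  -- (iv) but `S ≥ c² Y^{-1/2} #{m ≤ Y squarefree}` with `Y = q̂^{1+η} ≤ M`
  obtain ⟨Y, hY_def⟩ : ∃ Y : ℝ, Y = qhat q ^ (1 + η) := ⟨_, rfl⟩
  have hYpos : 0 < Y := by rw [hY_def]; exact Real.rpow_pos_of_pos hqhatpos _
  have hYM : Y ≤ M := by
    rw [hY_def, hM_def]
    exact Real.rpow_le_rpow_of_exponent_le hqhat1.le (by rw [hη_def]; linarith)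
  have hlogM : Real.log M = Δ' * Real.log (qhat q) := by rw [hM_def, Real.log_rpow hqhatpos]
  have hlogY : Real.log Y = (1 + η) * Real.log (qhat q) := by rw [hY_def, Real.log_rpow hqhatpos]
  have hMpos : 0 < M := by rw [hM_def]; exact Real.rpow_pos_of_pos hqhatpos _
  have hηL : 2 * (η * Real.log (qhat q)) = Δ' * Real.log (qhat q) - Real.log (qhat q) := by
    rw [hη_def]; ring
  have hratio : ∀ m : ℕ, 1 ≤ m → (m : ℝ) ≤ Y → c ≤ Real.log (M / m) / Real.log M := by
    intro m hm1 hmY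
    have hm0 : (0 : ℝ) < m := by exact_mod_cast hm1
    have hlogm : Real.log m ≤ (1 + η) * Real.log (qhat q) := by
      rw [← hlogY]
      exact Real.log_le_log hm0 hmY
    rw [Real.log_div hMpos.ne' hm0.ne', hlogM, le_div_iff₀ (by positivity)]
    have : c * (Δ' * Real.log (qhat q)) = η * Real.log (qhat q) := by rw [← mul_assoc, hcΔ]
    rw [this]
    nlinarith
  have hS_ge := rogueMollSum_X_sq_ge (M := M) hYpos.le hYM hc_pos.le hratio
  rw [← hS_def] at hS_ge
  -- the squarefree count and `Y ≥ 2`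
  have hcount := le_three_mul_card_squarefree ⌊Y⌋₊
  have hfloor : Y - 1 < (⌊Y⌋₊ : ℝ) := Nat.sub_one_lt_floor Y
  have hY2 : 2 ≤ Y := by
    have he : Real.exp 1 ≤ qhat q := by
      have := Real.exp_le_exp.mpr hlog1
      rwa [Real.exp_log hqhatpos] at this
    have h1e : (2 : ℝ) ≤ Real.exp 1 := by
      have := Real.add_one_le_exp (1 : ℝ)
      linarith
    have hqY : qhat q ≤ Y := by
      rw [hY_def]
      calc qhat q = qhat q ^ (1 : ℝ) := (Real.rpow_one _).symm
        _ ≤ qhat q ^ (1 + η) := Real.rpow_le_rpow_of_exponent_le hqhat1.le (by linarith)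
    linarith
  have hcard : Y / 6 ≤ (((Icc 1 ⌊Y⌋₊).filter Squarefree).card : ℝ) := by linarith
  -- `u = Y^{-1/2}` with `u² · Y = 1`
  obtain ⟨u, hu_def⟩ : ∃ u : ℝ, u = Y ^ (-(1 / 2 : ℝ)) := ⟨_, rfl⟩
  rw [← hu_def] at hS_ge
  have hupos : 0 < u := by rw [hu_def]; exact Real.rpow_pos_of_pos hYpos _
  have hu2 : u ^ 2 * Y = 1 := by
    rw [hu_def, sq, ← Real.rpow_add hYpos, show (-(1 / 2 : ℝ)) + -(1 / 2 : ℝ) = -1 by norm_num,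
      Real.rpow_neg_one, inv_mul_cancel₀ hYpos.ne']
  have hc2u : 0 ≤ c ^ 2 * u := by positivity
  have hS1 : c ^ 2 * u * (Y / 6) ≤ S := le_trans (mul_le_mul_of_nonneg_left hcard hc2u) hS_ge
  have hS0 : 0 ≤ c ^ 2 * u * (Y / 6) := by positivity
  have hS2 : c ^ 4 * Y / 36 ≤ S ^ 2 := by
    have h := pow_le_pow_left₀ hS0 hS1 2
    have hid : (c ^ 2 * u * (Y / 6)) ^ 2 = c ^ 4 * (u ^ 2 * Y) * Y / 36 := by ring
    rw [hid, hu2] at h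
    linarith
  -- `Y = q̂ · q̂^η` and `q̂^η ≥ B₀`
  have hYsplit : Y = qhat q * qhat q ^ η := by
    rw [hY_def, Real.rpow_add hqhatpos, Real.rpow_one]
  have hB₀le : B₀ ≤ qhat q ^ η := by
    have h1 : Real.log B₀ ≤ η * Real.log (qhat q) := by
      rw [div_le_iff₀ hη_pos] at hlogB
      linarith
    calc B₀ = Real.exp (Real.log B₀) := (Real.exp_log hB₀pos).symm
      _ ≤ Real.exp (η * Real.log (qhat q)) := Real.exp_le_exp.mpr h1
      _ = qhat q ^ η := by rw [Real.rpow_def_of_pos hqhatpos]; congr 1; ring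
  -- assemble the contradiction
  have hlow : K * qhat q + |C| * qhat q + qhat q ≤ 1 / (2 * Real.pi) * S ^ 2 := by
    have hπ : 0 < Real.pi := Real.pi_pos
    have hstep : K * qhat q + |C| * qhat q + qhat q =
        1 / (2 * Real.pi) * (c ^ 4 * (qhat q * B₀) / 36) := by
      rw [hB₀_def]
      field_simp
      ring
    rw [hstep]
    have hmono : qhat q * B₀ ≤ Y := by
      rw [hYsplit]
      exact mul_le_mul_of_nonneg_left hB₀le hqhatpos.le
    have hc4 : 0 ≤ c ^ 4 := by positivity
    have : c ^ 4 * (qhat q * B₀) / 36 ≤ S ^ 2 :=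
      le_trans (div_le_div_of_nonneg_right (mul_le_mul_of_nonneg_left hmono hc4) (by norm_num)) hS2
    exact mul_le_mul_of_nonneg_left this (by positivity)
  linarith

/-- COROLLARY (the transported K_A is violated by the rogue family): for every family of tables
with non-negative weights, `¬ MomentsBeyondDiagonalFam (rogueTables 𝓕)`. -/
theorem not_momentsBeyondDiagonalFam_rogue (𝓕 : Tables β) (h𝓕 : NonnegFam 𝓕) :
    ¬ MomentsBeyondDiagonalFam (rogueTables 𝓕) := by
  rintro ⟨Δ, hΔ, T₁, T₂, h⟩
  exact not_momentAsymptoticsFam_rogue 𝓕 h𝓕 hΔ T₁ T₂ h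

/-- In particular the rogue extension of the TRUE family (weights `≥ 0` PROVED) violates it. -/
theorem not_momentsBeyondDiagonalFam_rogue_true :
    ¬ MomentsBeyondDiagonalFam (rogueTables trueTables) :=
  not_momentsBeyondDiagonalFam_rogue trueTables nonnegFam_true


end Summit.Parity.GeneralizedHardyLittlewood.Theorems.PrimeLevelFamEdgeIdeaDeltas.Negation

end
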